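import Literature.NumberTheory.EllipticCurves.ModPReducibilityProofs
import Literature.NumberTheory.EllipticCurves.MazurTorsionSecondReductionProofs
import Literature.NumberTheory.EllipticCurves.NonEisensteinPrimeOfSurjective
import Literature.NumberTheory.EllipticCurves.MazurTorsion
import HarnessLib

/-!
# Eisenstein congruences at all good primes force a rational point of prime order in the
# isogeny class (Katz 1981, `m = ℓ`); with Mazur's torsion theorem, a non-Eisenstein good prime
# exists for every prime `ℓ ≥ 11`

Topic `Literature/NumberTheory/EllipticCurves`; theorems only (no definition, no named fact, no
instance).

## The results

Let `E/ℚ` be an elliptic curve and `ℓ` a prime.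

* `forall_exists_smul_eq_of_frobeniusTrace_congr` — if `a_r(E) ≡ r + 1 (mod ℓ)`, i.e.
  `ℓ ∣ #Ẽ(𝔽_r)`, for every prime `r ≠ ℓ` of good reduction, then **every** `σ ∈ Γ_ℚ` fixes a
  non-zero point of `E[ℓ]` (Frobenius' density theorem in division form, tree theorem
  `exists_frobenius_pow_smul_eq_geomTorsion`, and the reduction of torsion, tree theorem
  `exists_frobenius_smul_eq_of_dvd_reductionPointCount_holds`; this is the first half of the tree's
  proof of `not_irreducible_of_frobeniusTrace_congr_holds`, isolated).
* `exists_isogeny_addOrderOf_eq_of_forall_exists_smul_eq` — **Katz 1981, Thm. 2 at `m = ℓ`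
  (Cullinan–Kenney–Voight 2022, Cor. 2.3.6; Serre, *Abelian ℓ-adic representations*, p. I-2,
  Exercise)**: if every `σ ∈ Γ_ℚ` fixes a non-zero point of `E[ℓ]`, then either `E(ℚ)` has a
  point of order `ℓ`, or there is an `ℓ`-isogeny `E → E'` over `ℚ` with `E'(ℚ)[ℓ] ≠ 0`; recorded
  as: an isogeny `g : E → E'` over `ℚ` of degree dividing `ℓ` onto an elliptic curve with a
  rational point of order `ℓ`. PROOF (loc. cit., Lemma 2.3.5 and Cor. 2.3.6). By the tree's
  `Representation.exists_stable_addSubgroup_of_natCard_eq_sq` there is a `Γ_ℚ`-stable line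
  `H = ⟨P⟩ ⊂ E[ℓ]`. For `σ ∈ Γ_ℚ` with non-zero fixed vector `R`: if `R ∈ H` then `σ P = P`; if
  `R ∉ H` then `E[ℓ] = H + ℤR` and `σ T − T ∈ H` for all `T`. So `Γ_ℚ = A ∪ B` with the subgroups
  `A = Stab(P)`, `B = {σ : (σ − 1) E[ℓ] ⊆ H}`; a group is not the union of two proper subgroups,
  so `A = Γ_ℚ` — `P` is `Γ_ℚ`-fixed, hence the geometric point of a rational point of order `ℓ`
  (Galois descent, tree `exists_addOrderOf_eq_of_smul_eq`) — or `B = Γ_ℚ`: then for the quotient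
  isogeny `g : E → E' = E/H` over `ℚ` (tree theorem `exists_isogeny_ker_eq_and_comp_eq_nsmul_holds`,
  Silverman III.4.12) and `R ∉ H`, `g R ≠ O` is killed by `ℓ` and `σ (g R) = g (σ R) = g R`, a
  rational point of order `ℓ` on `E'`.
* `exists_isogeny_addOrderOf_eq_of_frobeniusTrace_congr`,
  `exists_isIsogenous_addOrderOf_eq_of_forall_dvd_lFunction_sub` — the two combined, for a
  globally minimal model (`a_r = W.frobeniusTrace r`) and for ANY model (`a_r = W.LFunction r`,
  good primes `r ∤ N_E`; via a global minimal model, `hasGlobalMinimalModel_rat_holds`).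
* `exists_prime_not_dvd_lFunction_sub_of_not_exists_addOrderOf`,
  `exists_prime_not_dvd_lFunction_sub_of_mazur_torsion` — **the non-Eisenstein good prime**:
  if no elliptic curve over `ℚ` has a rational point of order `ℓ` — for a prime `ℓ ≥ 11` this is
  Mazur's torsion theorem (tree named fact `mazur_torsion`, Mazur 1977 Thm. (8), in the order
  form `Mazur1977_addOrderOf_le_of_mazur_torsion`: orders `≤ 10` or `= 12`) — then every `E/ℚ`
  has a prime `r ≠ ℓ`, `r ∤ N_E`, with `a_r(E) ≢ r + 1 (mod ℓ)`. This is Pasten 2024, Lemma 6.7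
  with `β_S(ℓ) = 1` for ALL primes `ℓ ≥ 11` (printed: `ℓ > 163`, from Mazur's ISOGENY theorem,
  Lemma 6.3) and for all `E/ℚ` (no semi-stability hypothesis), hence the input of Lemma 6.14
  (`v_ℓ(i_p) = 0` for `ℓ ≥ 11`) from Mazur's TORSION theorem instead.

## References

* [Katz1980] N. M. Katz, *Galois properties of torsion points on abelian varieties*, Invent.
  Math. 62 (1981) 481–502, Thm. 2 (and Thm. 1, Lemma 1 p. 484). Not held; the case `m = ℓ` used
  here is restated and proved in [CullinanKenneyVoight2022], Lemma 2.3.5 and Cor. 2.3.6 (read).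
* [CullinanKenneyVoight2022] J. Cullinan, M. Kenney, J. Voight, *On a probabilistic local-global
  principle for torsion on elliptic curves*, J. Théor. Nombres Bordeaux 34 (2022) 41–90, §2.3,
  Thm. 2.3.1, Lemma 2.3.5, Cor. 2.3.6 (read, pp. 12–13 of the numdam text).
* [Mazur1977] B. Mazur, *Modular curves and the Eisenstein ideal*, Publ. Math. IHÉS 47 (1977),
  Thm. (8) (= Ch. III Thm. (5.1), Cor. (5.2)).
* [PastenShimura2024] H. Pasten, *Shimura curves and the abc conjecture*, J. Number Theory 254
  (2024) = arXiv:1705.09251, Lemma 6.3, Lemma 6.7 (p. 22), Lemma 6.14 (p. 23) (read).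
* [SilvermanAEC2009] J. H. Silverman, *The Arithmetic of Elliptic Curves*, 2nd ed.: III.4.12,
  III.6.4(b), VII.3.1(b), VIII.§1.

## Design

Theorems only, `namespace Literature.NumberTheory.EllipticCurves`; axioms of every theorem:
`propext`, `Classical.choice`, `Quot.sound`. The `𝔽_ℓ`-structure on `E[ℓ]` is introduced locally
(`letI`) only to call the invariant-line lemma; the rest of the argument is written additively
(`ℤ`-multiples, Lagrange), frame-free.
-/

noncomputable section

open scoped Classical

open NumberField IsDedekindDomain Field WeierstrassCurve

namespace Literature.NumberTheory.EllipticCurves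

/-! ### Every `σ` fixes a non-zero point of `E[ℓ]` -/

/-- **Eisenstein traces at all good primes ⇒ every `σ ∈ Γ_ℚ` has a non-zero fixed vector in
`E[p]`.** For a globally minimal `W/ℚ` and a prime `p`: if `p ∣ a_ℓ(W) − ℓ − 1`, i.e.
`p ∣ #W̃(𝔽_ℓ)`, for every prime `ℓ ≠ p` of good reduction, then every `σ ∈ Γ_ℚ` fixes a non-zero
point of `E[p]`. By Frobenius' density theorem (division form,
`exists_frobenius_pow_smul_eq_geomTorsion`) `σ` acts on `E[p]` as a power `φ^j` of an arithmetic
Frobenius `φ` above a prime `ℓ ∉ {p} ∪ {ℓ ∣ Δ_min}`, which is good, and `φ` fixes a non-zero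
`P ∈ E[p]` by the reduction of torsion (`exists_frobenius_smul_eq_of_dvd_reductionPointCount_holds`);
so does `φ^j`. (The first half of the tree's proof of `not_irreducible_of_frobeniusTrace_congr_holds`.)
[cite: CullinanKenneyVoight2022, Thm. 2.3.1 and Cor. 2.3.6 (hypothesis)] [cite: SilvermanAEC2009, Prop. VII.3.1(b)] -/
theorem forall_exists_smul_eq_of_frobeniusTrace_congr (W : WeierstrassCurve ℚ) [W.IsElliptic]
    [W.IsGloballyMinimal] (p : ℕ) [Fact p.Prime]
    (hcongr : ∀ (ℓ : ℕ) [Fact ℓ.Prime], ℓ ≠ p → W.HasGoodReductionAtPrime ℓ →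
        (p : ℤ) ∣ W.frobeniusTrace ℓ - (ℓ + 1))
    (σ : absoluteGaloisGroup ℚ) : ∃ P : W.geomTorsion p, P ≠ 0 ∧ σ • P = P := by
  classical
  have hp : p.Prime := Fact.out
  -- the excluded primes: `p` and the divisors of the minimal discriminant
  have hΔ0 : minimalDiscriminantInt W ≠ 0 := minimalDiscriminantInt_ne_zero W
  let S : Set ℕ := {ℓ | ℓ = p ∨ (ℓ : ℤ) ∣ minimalDiscriminantInt W}
  have hS : S.Finite := by
    refine (Set.finite_le_nat (max p (minimalDiscriminantInt W).natAbs)).subset ?_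
    rintro ℓ (rfl | hℓ)
    · exact Set.mem_setOf.mpr (le_max_left _ _)
    · exact Set.mem_setOf.mpr (le_max_of_le_right
        (Nat.le_of_dvd (Int.natAbs_pos.mpr hΔ0) (Int.natCast_dvd.mp hℓ)))
  obtain ⟨ℓ, v, 𝔓, φ, hℓ, hℓS, hv, h𝔓, hφ, j, hagree⟩ :=
    exists_frobenius_pow_smul_eq_geomTorsion W (n := p) (by exact_mod_cast hp.ne_zero) S hS σ
  haveI : Fact ℓ.Prime := ⟨hℓ⟩
  have hℓp : ℓ ≠ p := fun h ↦ hℓS (Or.inl h)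
  have hℓΔ : ¬ (ℓ : ℤ) ∣ minimalDiscriminantInt W := fun h ↦ hℓS (Or.inr h)
  have hgood : W.HasGoodReductionAtPrime ℓ := hasGoodReductionAtPrime_of_not_dvd W ℓ hℓΔ
  have hdvd : p ∣ W.reductionPointCount ℓ :=
    (dvd_frobeniusTrace_sub_iff W p ℓ).mp (hcongr ℓ hℓp hgood)
  obtain ⟨P, hP0, hP⟩ :=
    exists_frobenius_smul_eq_of_dvd_reductionPointCount_holds W p ℓ hℓp hgood hdvd v hv 𝔓 h𝔓 φ hφ
  -- `φ • P = P`, hence `φ ^ j • P = P`, i.e. `σ • P = P`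
  refine ⟨P, hP0, ?_⟩
  rw [hagree P]
  exact MulAction.mem_stabilizer_iff.mp
    (Subgroup.pow_mem (MulAction.stabilizer (absoluteGaloisGroup ℚ) P)
      (MulAction.mem_stabilizer_iff.mpr hP) j)

/-! ### Katz 1981, Thm. 2 at `m = ℓ`: a rational point of order `ℓ` up to an `ℓ`-isogeny -/

/-- **A group is not the union of two proper subgroups** (here for two predicates on a group closed
under the operations, in the form used below): if every element satisfies `A` or `B`, where `A`
and `B` are each closed under products and `B` under the "quotient" `σ₁⁻¹`-free form
`B (σ₁ σ₂) → B σ₁ → B σ₂`, `A (σ₁ σ₂) → A σ₂ → A σ₁`, then `A` holds everywhere or `B` does.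
[folklore] -/
theorem forall_or_forall_of_forall_or {G : Type*} [Mul G] {A B : G → Prop}
    (h : ∀ g, A g ∨ B g) (hA : ∀ g₁ g₂, A (g₁ * g₂) → A g₂ → A g₁)
    (hB : ∀ g₁ g₂, B (g₁ * g₂) → B g₁ → B g₂) : (∀ g, A g) ∨ (∀ g, B g) := by
  by_contra hne
  push Not at hne
  obtain ⟨⟨g₁, hg₁⟩, ⟨g₂, hg₂⟩⟩ := hne
  have hB₁ : B g₁ := (h g₁).resolve_left hg₁
  have hA₂ : A g₂ := (h g₂).resolve_right hg₂
  rcases h (g₁ * g₂) with h12 | h12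
  · exact hg₁ (hA g₁ g₂ h12 hA₂)
  · exact hg₂ (hB g₁ g₂ h12 hB₁)

/-- **Katz 1981, Thm. 2 for `m = ℓ` prime / Cullinan–Kenney–Voight 2022, Cor. 2.3.6 / Serre's
exercise.** Let `E/ℚ` be an elliptic curve (any Weierstrass model `W`) and `ℓ` a prime such that
every `σ ∈ Γ_ℚ` fixes a non-zero point of `E[ℓ]` (e.g. `ℓ ∣ #Ẽ(𝔽_r)` for all good `r ≠ ℓ`,
`forall_exists_smul_eq_of_frobeniusTrace_congr`). Then there are an elliptic curve `E'/ℚ` and an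
isogeny `g : E → E'` over `ℚ` of degree dividing `ℓ` (so `g` is an isomorphism onto `E' = E`, or
an `ℓ`-isogeny) such that `E'(ℚ)` has a point of order `ℓ`. Printed (CKV Cor. 2.3.6): "If
`ℓ ∣ #E(𝔽_𝔭)` for a set of primes of `K` of density `1`, then at least one of the following
holds: (i) `E(K)[ℓ] ≠ {∞}`; or (ii) there is a cyclic `ℓ`-isogeny `E → E'` over `K` where
`E'(K)[ℓ] ≠ {∞}`", proved from Lemma 2.3.5 (a subgroup `G ≤ GL₂(k)` with `det(1 − g) = 0` for all
`g ∈ G` is, in some basis, inside `(1 *; 0 *)` or `(* *; 0 1)`; Serre [28, p. I-2, Exercise 1];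
Katz [19, Lemma 1, p. 484]) with `E' := E/⟨P₁⟩`. Proof here: module docstring (invariant line
`H = ⟨P⟩` from the tree's `Representation.exists_stable_addSubgroup_of_natCard_eq_sq`; the
dichotomy `Γ_ℚ = Stab(P) ∪ {σ : (σ − 1)E[ℓ] ⊆ H}`; Galois descent `exists_addOrderOf_eq_of_smul_eq`;
the quotient isogeny `exists_isogeny_ker_eq_and_comp_eq_nsmul_holds`).
[cite: CullinanKenneyVoight2022, Lemma 2.3.5 and Cor. 2.3.6] [cite: Katz1980, Thm. 2 (m = ℓ) and Lemma 1 p. 484] -/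
theorem exists_isogeny_addOrderOf_eq_of_forall_exists_smul_eq (W : WeierstrassCurve ℚ)
    [W.IsElliptic] (p : ℕ) [Fact p.Prime]
    (hfix : ∀ σ : absoluteGaloisGroup ℚ, ∃ P : W.geomTorsion p, P ≠ 0 ∧ σ • P = P) :
    ∃ (W' : WeierstrassCurve ℚ) (_ : W'.IsElliptic) (g : Isogeny W W'),
      g.degree ∣ p ∧ ∃ Q : W'.toAffine.Point, addOrderOf Q = p := by
  classical
  have hp : p.Prime := Fact.out
  haveI : NeZero (p : ℚ) := ⟨Nat.cast_ne_zero.mpr hp.ne_zero⟩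
  -- `E[p]` is an `𝔽_p`-plane
  have hcard : Nat.card (W.geomTorsion p) = p ^ 2 := natCard_geomTorsion W p
  haveI hfin : Finite (W.geomTorsion p) :=
    Nat.finite_of_card_ne_zero (by rw [hcard]; exact pow_ne_zero 2 hp.ne_zero)
  -- `ℤ`-multiples commute with the Galois action
  have hσz : ∀ (σ : absoluteGaloisGroup ℚ) (k : ℤ) (T : W.geomTorsion p),
      σ • (k • T) = k • σ • T := fun σ k T ↦ by
    rw [← DistribMulAction.toAddMonoidHom_apply, map_zsmul, DistribMulAction.toAddMonoidHom_apply]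
  -- an invariant line `H`
  obtain ⟨H, hH, hbot, htop⟩ : ∃ H : AddSubgroup (W.geomTorsion p),
      (∀ σ : absoluteGaloisGroup ℚ, ∀ a ∈ H, σ • a ∈ H) ∧ H ≠ ⊥ ∧ H ≠ ⊤ := by
    letI : Module (ZMod p) (W.geomTorsion p) := AddSubgroup.torsionBy.zmodModule
    exact Literature.RepresentationTheory.FiniteGroups.Representation.exists_stable_addSubgroup_of_natCard_eq_sq
      hcard hfix
  -- `#H = p`
  have hHcard : Nat.card H = p := by
    have hdvd : Nat.card H ∣ Nat.card (W.geomTorsion p) := AddSubgroup.card_addSubgroup_dvd_card H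
    rw [hcard] at hdvd
    obtain ⟨k, hk, hk'⟩ := (Nat.dvd_prime_pow hp).mp hdvd
    interval_cases k
    · exact absurd (AddSubgroup.eq_bot_of_card_eq H (by simpa using hk')) hbot
    · simpa using hk'
    · exact absurd ((AddSubgroup.card_eq_iff_eq_top H).mp (hk'.trans hcard.symm)) htop
  -- a generator `P₀` of `H`
  haveI : Finite H := Finite.of_injective _ Subtype.coe_injective
  haveI : Nontrivial H := Finite.one_lt_card_iff_nontrivial.mp (by rw [hHcard]; exact hp.one_lt)
  obtain ⟨⟨P₀, hP₀H⟩, hP₀'⟩ := exists_ne (0 : H)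
  have hP₀0 : P₀ ≠ 0 := fun h ↦ hP₀' (Subtype.ext h)
  have hordP₀ : addOrderOf P₀ = p := addOrderOf_eq_of_ne_zero W p hP₀0
  have hHeq : AddSubgroup.zmultiples P₀ = H := by
    refine AddSubgroup.eq_of_le_of_card_ge (AddSubgroup.zmultiples_le.mpr hP₀H) ?_
    rw [hHcard, Nat.card_zmultiples, hordP₀]
  -- the scalar by which `σ` acts on `P₀`
  have hσP₀ : ∀ σ : absoluteGaloisGroup ℚ, ∃ m : ℤ, σ • P₀ = m • P₀ := fun σ ↦ by
    have h := hH σ P₀ hP₀H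
    rw [← hHeq, AddSubgroup.mem_zmultiples_iff] at h
    obtain ⟨m, hm⟩ := h
    exact ⟨m, hm.symm⟩
  -- `p ∣ k` iff `k • P₀ = 0`
  have hzP₀ : ∀ k : ℤ, k • P₀ = 0 ↔ (p : ℤ) ∣ k := fun k ↦ by
    have h := addOrderOf_dvd_iff_zsmul_eq_zero (x := P₀) (i := k)
    rw [hordP₀] at h
    exact h.symm
  -- the dichotomy, element by element: `σ P₀ = P₀` or `(σ − 1) E[p] ⊆ H`
  have hdich : ∀ σ : absoluteGaloisGroup ℚ,
      σ • P₀ = P₀ ∨ ∀ T : W.geomTorsion p, σ • T - T ∈ H := by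
    intro σ
    obtain ⟨R, hR0, hσR⟩ := hfix σ
    obtain ⟨m, hm⟩ := hσP₀ σ
    by_cases hRH : R ∈ H
    · -- `R = k • P₀` is fixed, so `σ` acts trivially on the line
      left
      rw [← hHeq, AddSubgroup.mem_zmultiples_iff] at hRH
      obtain ⟨k, rfl⟩ := hRH
      have hk : ¬ (p : ℤ) ∣ k := fun h ↦ hR0 ((hzP₀ k).mpr h)
      have h1 : (k * (m - 1)) • P₀ = 0 := by
        have h2 : σ • (k • P₀) = (k * m) • P₀ := by rw [hσz, hm, smul_smul]
        rw [mul_sub, mul_one, sub_smul, ← h2, hσR, sub_self]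
      have h3 : (p : ℤ) ∣ m - 1 :=
        ((Nat.prime_iff_prime_int.mp hp).dvd_or_dvd ((hzP₀ _).mp h1)).resolve_left hk
      rw [hm]
      calc m • P₀ = (m - 1) • P₀ + P₀ := by rw [sub_smul, one_smul, sub_add_cancel]
        _ = P₀ := by rw [(hzP₀ _).mpr h3, zero_add]
    · -- `E[p] = H + ℤ R`, and `σ` fixes `R`
      right
      have htop' : H ⊔ AddSubgroup.zmultiples R = ⊤ := by
        set K := H ⊔ AddSubgroup.zmultiples R with hK
        have hHK : H ≤ K := le_sup_left
        have hRK : R ∈ K := (le_sup_right : AddSubgroup.zmultiples R ≤ K)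
          (AddSubgroup.mem_zmultiples R)
        have hne : H ≠ K := fun h ↦ hRH (h ▸ hRK)
        haveI : Finite K := Finite.of_injective _ Subtype.coe_injective
        have hKdvd : Nat.card K ∣ Nat.card (W.geomTorsion p) :=
          AddSubgroup.card_addSubgroup_dvd_card K
        rw [hcard] at hKdvd
        have hHdvdK : Nat.card H ∣ Nat.card K := AddSubgroup.card_dvd_of_le hHK
        rw [hHcard] at hHdvdK
        obtain ⟨k, hk, hk'⟩ := (Nat.dvd_prime_pow hp).mp hKdvd
        interval_cases k
        · rw [hk', pow_zero] at hHdvdK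
          exact absurd (Nat.le_of_dvd one_pos hHdvdK) (not_le.mpr hp.one_lt)
        · exact absurd (AddSubgroup.eq_of_le_of_card_ge hHK (by rw [hk', pow_one, hHcard])) hne
        · exact (AddSubgroup.card_eq_iff_eq_top K).mp (hk'.trans hcard.symm)
      intro T
      have hT : T ∈ H ⊔ AddSubgroup.zmultiples R := by rw [htop']; exact AddSubgroup.mem_top T
      obtain ⟨h, hh, z, hz, rfl⟩ := AddSubgroup.mem_sup.mp hT
      obtain ⟨k, rfl⟩ := AddSubgroup.mem_zmultiples_iff.mp hz
      have h1 : σ • (h + k • R) - (h + k • R) = σ • h - h := by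
        rw [smul_add, hσz, hσR]; abel
      rw [h1]
      exact H.sub_mem (hH σ h hh) hh
  -- hence `Stab(P₀) = Γ_ℚ` or `{σ : (σ − 1) E[p] ⊆ H} = Γ_ℚ`
  have hcases : (∀ σ : absoluteGaloisGroup ℚ, σ • P₀ = P₀) ∨
      ∀ (σ : absoluteGaloisGroup ℚ) (T : W.geomTorsion p), σ • T - T ∈ H := by
    refine forall_or_forall_of_forall_or hdich (fun σ₁ σ₂ h12 h2 ↦ ?_) (fun σ₁ σ₂ h12 h1 T ↦ ?_)
    · rw [mul_smul, h2] at h12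
      exact h12
    · have h3 : (σ₁ * σ₂) • T - T - (σ₁ • (σ₂ • T) - σ₂ • T) = σ₂ • T - T := by
        rw [mul_smul]; abel
      rw [← h3]
      exact H.sub_mem (h12 T) (h1 (σ₂ • T))
  rcases hcases with hA | hB
  · -- `P₀` is `Γ_ℚ`-fixed: a rational point of order `p` on `W` itself
    obtain ⟨Q, hQ, -⟩ := exists_addOrderOf_eq_of_smul_eq W hP₀0 hA
    exact ⟨W, inferInstance, Isogeny.id W, by rw [Isogeny.degree_id]; exact one_dvd p, Q, hQ⟩
  · -- the quotient `W' = W/H` carries a rational point of order `p`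
    set S : AddSubgroup W.geomPoints := H.map (W.geomTorsion p).subtype with hSdef
    have hSfin : (S : Set W.geomPoints).Finite := by
      haveI : Finite S := by
        rw [hSdef]
        exact Finite.of_surjective (fun x : H ↦ (⟨(W.geomTorsion p).subtype x.1,
          AddSubgroup.mem_map_of_mem _ x.2⟩ : H.map (W.geomTorsion p).subtype))
          (fun ⟨y, hy⟩ ↦ by
            obtain ⟨x, hx, rfl⟩ := AddSubgroup.mem_map.mp hy
            exact ⟨⟨x, hx⟩, rfl⟩)
      exact Set.toFinite _
    have hSmem : ∀ T : W.geomTorsion p, (T : W.geomPoints) ∈ S ↔ T ∈ H := by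
      intro T
      rw [hSdef, AddSubgroup.mem_map]
      constructor
      · rintro ⟨x, hx, hxT⟩
        have : x = T := Subtype.ext hxT
        exact this ▸ hx
      · exact fun hT ↦ ⟨T, hT, rfl⟩
    have hSstab : ∀ (σ : absoluteGaloisGroup ℚ) (Q : W.geomPoints), Q ∈ S → σ • Q ∈ S := by
      intro σ Q hQ
      rw [hSdef, AddSubgroup.mem_map] at hQ
      obtain ⟨T, hT, rfl⟩ := hQ
      have h1 : σ • ((W.geomTorsion p).subtype T) = ((σ • T : W.geomTorsion p) : W.geomPoints) :=
        (AddSubgroup.torsionBy.coe_smul σ T).symm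
      rw [h1]
      exact (hSmem _).mpr (hH σ T hT)
    obtain ⟨W', hW', g, -, hker, -, -⟩ :=
      exists_isogeny_ker_eq_and_comp_eq_nsmul_holds W S hSfin hSstab
    haveI := hW'
    -- a point `R ∉ H`
    obtain ⟨R, hRH⟩ : ∃ R : W.geomTorsion p, R ∉ H := by
      by_contra hall
      push Not at hall
      exact htop (eq_top_iff.mpr fun T _ ↦ hall T)
    -- its image `g R` is a non-zero `Γ_ℚ`-fixed point killed by `p`
    have hpR : (p : ℤ) • (R : W.geomPoints) = 0 :=
      (mem_torsionPoints_iff W (AlgebraicClosure ℚ) (R : geomPoints W)).mp R.2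
    have hgR_mem : g (R : W.geomPoints) ∈ W'.geomTorsion p := by
      rw [mem_torsionBy_iff, ← map_zsmul, hpR, map_zero]
    have hgR0 : (⟨g (R : W.geomPoints), hgR_mem⟩ : W'.geomTorsion p) ≠ 0 := by
      intro h0
      have h1 : g (R : W.geomPoints) = 0 := congrArg Subtype.val h0
      have h2 : (R : W.geomPoints) ∈ g.toAddMonoidHom.ker := h1
      rw [hker] at h2
      exact hRH ((hSmem R).mp h2)
    have hgRfix : ∀ σ : absoluteGaloisGroup ℚ,
        σ • (⟨g (R : W.geomPoints), hgR_mem⟩ : W'.geomTorsion p) = ⟨g (R : W.geomPoints), hgR_mem⟩ := by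
      intro σ
      apply Subtype.ext
      rw [AddSubgroup.torsionBy.coe_smul]
      change σ • g (R : W.geomPoints) = g (R : W.geomPoints)
      rw [← Isogeny.map_smul]
      -- `σ R − R ∈ H`, so `g (σ R) = g R`
      have h1 : ((σ • R - R : W.geomTorsion p) : W.geomPoints) ∈ g.toAddMonoidHom.ker := by
        rw [hker]
        exact (hSmem _).mpr (hB σ R)
      have h2 : g ((σ • R - R : W.geomTorsion p) : W.geomPoints) = 0 := h1
      rw [AddSubgroupClass.coe_sub, AddSubgroup.torsionBy.coe_smul, map_sub, sub_eq_zero] at h2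
      exact h2
    obtain ⟨Q, hQ, -⟩ := exists_addOrderOf_eq_of_smul_eq W' hgR0 hgRfix
    refine ⟨W', hW', g, ?_, Q, hQ⟩
    -- `deg g = #ker g = #S = #H = p`
    have hdeg : g.degree = p := by
      rw [Isogeny.degree, hker, hSdef,
        AddSubgroup.card_map_of_injective Subtype.coe_injective, hHcard]
    rw [hdeg]

/-- **The same from the Eisenstein congruences** (Katz 1981, Thm. 2, `m = ℓ`, for `K = ℚ`: "if
`#E(𝔽_p) ≡ 0 mod m` for a set of primes of density one, there is `E'` isogenous to `E` over `ℚ`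
with `m ∣ #E'(ℚ)_tors`"), for a globally minimal `W` (`a_ℓ = W.frobeniusTrace ℓ`): if
`p ∣ a_ℓ(W) − ℓ − 1` for every good prime `ℓ ≠ p`, there is an isogeny `g : W → W'` over `ℚ` of
degree dividing `p` onto an elliptic curve with a rational point of order `p`.
[cite: CullinanKenneyVoight2022, Cor. 2.3.6] [cite: Katz1980, Thm. 2 (m = ℓ)] -/
theorem exists_isogeny_addOrderOf_eq_of_frobeniusTrace_congr (W : WeierstrassCurve ℚ)
    [W.IsElliptic] [W.IsGloballyMinimal] (p : ℕ) [Fact p.Prime]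
    (hcongr : ∀ (ℓ : ℕ) [Fact ℓ.Prime], ℓ ≠ p → W.HasGoodReductionAtPrime ℓ →
        (p : ℤ) ∣ W.frobeniusTrace ℓ - (ℓ + 1)) :
    ∃ (W' : WeierstrassCurve ℚ) (_ : W'.IsElliptic) (g : Isogeny W W'),
      g.degree ∣ p ∧ ∃ Q : W'.toAffine.Point, addOrderOf Q = p :=
  exists_isogeny_addOrderOf_eq_of_forall_exists_smul_eq W p
    (forall_exists_smul_eq_of_frobeniusTrace_congr W p hcongr)

/-- **Katz's theorem at `m = ℓ` for an arbitrary model**, coefficients `a_ℓ(E) = W.LFunction ℓ`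
(Mathlib's `WeierstrassCurve.LFunction`, built from local minimal models) and good primes read as
`ℓ ∤ N_E`: if `p ∣ a_ℓ(E) − ℓ − 1` for every prime `ℓ ≠ p` not dividing the conductor, then some
elliptic curve `ℚ`-isogenous to `W` (tree `IsIsogenous`) has a rational point of order `p`.
Through a global minimal model `C • W` (`hasGlobalMinimalModel_rat_holds`; `L`-function and
conductor are model invariants, `LFunction_smul`, `conductorNorm_smul`; at a good prime
`a_ℓ = frobeniusTrace`, `LFunction_apply_prime_eq_frobeniusTrace`, and `ℓ ∤ N_E`,
`not_dvd_conductorNorm_of_hasGoodReductionAtPrime`), and `W ~ C • W` (`isIsogenous_smul`).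
[cite: CullinanKenneyVoight2022, Cor. 2.3.6] [cite: Katz1980, Thm. 2 (m = ℓ)] -/
theorem exists_isIsogenous_addOrderOf_eq_of_forall_dvd_lFunction_sub (W : WeierstrassCurve ℚ)
    [W.IsElliptic] (p : ℕ) [Fact p.Prime]
    (h : ∀ ℓ : ℕ, ℓ.Prime → ℓ ≠ p → ¬ ℓ ∣ W.conductorNorm ℤ →
        (p : ℤ) ∣ W.LFunction ℓ - (ℓ + 1)) :
    ∃ (W' : WeierstrassCurve ℚ) (_ : W'.IsElliptic), IsIsogenous W W' ∧
      ∃ Q : W'.toAffine.Point, addOrderOf Q = p := by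
  obtain ⟨C, hC⟩ := hasGlobalMinimalModel_rat_holds W
  haveI := hC
  have hcongr : ∀ (ℓ : ℕ) [Fact ℓ.Prime], ℓ ≠ p → (C • W).HasGoodReductionAtPrime ℓ →
      (p : ℤ) ∣ (C • W).frobeniusTrace ℓ - (ℓ + 1) := by
    intro ℓ _ hℓp hgood
    have hN : ¬ ℓ ∣ W.conductorNorm ℤ := by
      rw [← conductorNorm_smul ℤ W C]
      exact not_dvd_conductorNorm_of_hasGoodReductionAtPrime (C • W) hgood
    rw [← LFunction_apply_prime_eq_frobeniusTrace (C • W) ℓ hgood, LFunction_smul W C]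
    exact h ℓ Fact.out hℓp hN
  obtain ⟨W', hW', g, -, Q, hQ⟩ :=
    exists_isogeny_addOrderOf_eq_of_frobeniusTrace_congr (C • W) p hcongr
  haveI := hW'
  exact ⟨W', hW', (isIsogenous_smul W C).trans' ⟨g⟩, Q, hQ⟩

/-! ### The non-Eisenstein good prime, from the absence of rational `ℓ`-torsion (Mazur) -/

/-- **A good prime `r ≠ ℓ`, `r ∤ N_E`, with `a_r(E) ≢ r + 1 (mod ℓ)`, granted that no elliptic
curve over `ℚ` has a rational point of order `ℓ`** (contrapositive of Katz's theorem at `m = ℓ`,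
`exists_isIsogenous_addOrderOf_eq_of_forall_dvd_lFunction_sub`). For any model `W` of `E/ℚ`,
`a_r(E) = W.LFunction r`. [cite: CullinanKenneyVoight2022, Cor. 2.3.6] [cite: Katz1980, Thm. 2 (m = ℓ)] -/
theorem exists_prime_not_dvd_lFunction_sub_of_not_exists_addOrderOf (W : WeierstrassCurve ℚ)
    [W.IsElliptic] (p : ℕ) [Fact p.Prime]
    (hno : ∀ (V : WeierstrassCurve ℚ) [V.IsElliptic], ¬ ∃ Q : V.toAffine.Point, addOrderOf Q = p) :
    ∃ ℓ : ℕ, ℓ.Prime ∧ ℓ ≠ p ∧ ¬ ℓ ∣ W.conductorNorm ℤ ∧ ¬ (p : ℤ) ∣ W.LFunction ℓ - (ℓ + 1) := by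
  by_contra hne
  push Not at hne
  obtain ⟨W', hW', -, Q, hQ⟩ :=
    exists_isIsogenous_addOrderOf_eq_of_forall_dvd_lFunction_sub W p
      fun ℓ hℓ hℓp hN ↦ hne ℓ hℓ hℓp hN
  haveI := hW'
  exact hno W' ⟨Q, hQ⟩

/-- **Mazur's torsion theorem excludes rational points of prime order `ℓ ≥ 11`** (Mazur 1977,
Thm. (8) / Cor. III.(5.2): every rational torsion point has order `≤ 10` or `= 12`; tree named
fact `mazur_torsion` in the order form `Mazur1977_addOrderOf_le_of_mazur_torsion`).
[cite: Mazur1977, Thm. (8) and Cor. III.(5.2) p. 156] -/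
theorem not_exists_addOrderOf_eq_of_mazur_torsion (V : WeierstrassCurve ℚ) [V.IsElliptic]
    (hMT : mazur_torsion V) {p : ℕ} (hp : p.Prime) (h11 : 11 ≤ p) :
    ¬ ∃ Q : V.toAffine.Point, addOrderOf Q = p := by
  rintro ⟨Q, hQ⟩
  have hfin : IsOfFinAddOrder Q := by
    rw [← addOrderOf_pos_iff, hQ]
    exact hp.pos
  have h := Mazur1977_addOrderOf_le_of_mazur_torsion V hMT Q hfin
  rw [hQ] at h
  rcases h with h | h
  · omega
  · rw [h] at hp
    norm_num at hp

/-- **Pasten 2024, Lemma 6.7 with `β(ℓ) = 1` for every prime `ℓ ≥ 11`, from Mazur's TORSION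
theorem** (printed for `ℓ > 163` as Lemma 6.3, from Mazur's isogeny theorem and Ribet's
argument): granted `mazur_torsion` for all elliptic curves over `ℚ`, for every prime `ℓ ≥ 11`
and every elliptic curve `E/ℚ` (any model `W`, no semi-stability hypothesis) there is a prime
`r ≠ ℓ`, `r ∤ N_E`, with `a_r(E) ≢ r + 1 (mod ℓ)`. For otherwise, by Katz's theorem at `m = ℓ`
(`exists_isIsogenous_addOrderOf_eq_of_forall_dvd_lFunction_sub`), some curve `ℚ`-isogenous to
`E` would have a rational point of order `ℓ ≥ 11`. This is the input of Pasten's Lemma 6.14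
(`v_ℓ(i_p(D, M)) = 0`) at all primes `ℓ ≥ 11`. [cite: PastenShimura2024, Lemma 6.7 p. 22 and Lemma 6.3 p. 21] [cite: Mazur1977, Thm. (8)] [cite: Katz1980, Thm. 2 (m = ℓ)] -/
theorem exists_prime_not_dvd_lFunction_sub_of_mazur_torsion
    (hMT : ∀ V : WeierstrassCurve ℚ, mazur_torsion V) (W : WeierstrassCurve ℚ) [W.IsElliptic]
    (p : ℕ) [Fact p.Prime] (h11 : 11 ≤ p) :
    ∃ ℓ : ℕ, ℓ.Prime ∧ ℓ ≠ p ∧ ¬ ℓ ∣ W.conductorNorm ℤ ∧ ¬ (p : ℤ) ∣ W.LFunction ℓ - (ℓ + 1) :=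
  exists_prime_not_dvd_lFunction_sub_of_not_exists_addOrderOf W p fun V _ ↦
    not_exists_addOrderOf_eq_of_mazur_torsion V (hMT V) Fact.out h11

/-- **The same from the printed leaves of Mazur's theorem** (`Mazur1977_no_prime_torsion`: no
rational point of prime order `N ∉ {2, 3, 5, 7, 13}`, Mazur 1977 Ch. III §5; and Mazur–Tate 1973
for `13`, `MazurTate1973_no_torsion_thirteen`), for every prime `ℓ ≥ 11`.
[cite: Mazur1977, Ch. III §5, pp. 156–160] [cite: Katz1980, Thm. 2 (m = ℓ)] -/
theorem exists_prime_not_dvd_lFunction_sub_of_mazur_leaves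
    (h5 : ∀ V : WeierstrassCurve ℚ, Mazur1977_no_prime_torsion V)
    (h13 : ∀ V : WeierstrassCurve ℚ, MazurTate1973_no_torsion_thirteen V)
    (W : WeierstrassCurve ℚ) [W.IsElliptic] (p : ℕ) [Fact p.Prime] (h11 : 11 ≤ p) :
    ∃ ℓ : ℕ, ℓ.Prime ∧ ℓ ≠ p ∧ ¬ ℓ ∣ W.conductorNorm ℤ ∧ ¬ (p : ℤ) ∣ W.LFunction ℓ - (ℓ + 1) := by
  have hp : p.Prime := Fact.out
  refine exists_prime_not_dvd_lFunction_sub_of_not_exists_addOrderOf W p fun V _ ↦ ?_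
  by_cases hp13 : p = 13
  · subst hp13
    exact h13 V
  · refine h5 V p hp ?_
    simp only [Finset.mem_insert, Finset.mem_singleton, not_or]
    omega

end Literature.NumberTheory.EllipticCurves

end
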